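import Mathlib
import Literature.Analysis.FluidPDE.GaussianVortexPlanar
import Literature.Analysis.FluidPDE.GaussianVortexPlanarProofs
import Literature.Analysis.FluidPDE.WholeSpaceIBP
import HarnessLib

/-!
# Helper for stub `stub_coreInverse` (line `braid-closed-large-circulation-gluing`, crux stmt-AnomalousDissipation-3009):
# the quadratic form of the cut-off strain in `L²(G⁻¹)`

For the cut-off strain term of the core operator, `S w = χ (Bξ)·∇w + (∇χ·Bξ) w = div(χ Bξ w)`
(`Bξ = (b₁ξ₀ + b₂ξ₁, b₂ξ₀ − b₁ξ₁)`, trace-free), and any `w ∈ C¹`, `χ ∈ C¹_c`: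

  `⟨S w, w⟩_{L²(G⁻¹)} = ∫ G⁻¹ w (χ Bξ·∇w + (∇χ·Bξ) w) = ∫ G⁻¹ w² (½ ∇χ·Bξ − ¼ χ ξ·Bξ)`

(`coreStrain_form_identity`): one integration by parts on the whole plane (`∫ θ div ψ + ∫ ⟪ψ, ∇θ⟫ = 0` with
`θ = G⁻¹w²`, `ψ = χ Bξ`, tree `integral_mul_divergence_add_eq_zero_right`), using `div(Bξ) = tr B = 0` and
`∇G⁻¹ = ½ ξ G⁻¹`. The right-hand side is a POTENTIAL term: no derivative of `w`, supported in `supp χ`, of size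
`≤ |B|(‖∇χ‖_∞|ξ| + |ξ|²/4)`, and with ZERO CIRCULAR MEAN (both `∇χ·Bξ` for radial `χ` and `ξ·Bξ = b₁(ξ₀²−ξ₁²) + 2b₂ξ₀ξ₁`
are pure `m = ±2` harmonics) — this is the "anti-confining conjugated potential `−χ ξᵀBξ/4`" of the planner's docstring and
the reason the strain couples the radial block only to the `m = ±2` block in the energy method for `stub_coreInverse`.

References: Th. Gallay, Y. Maekawa, arXiv:1610.08384 §4.1 (the operator `M = ½(x₁∂₁ − x₂∂₂)`); Gallay–Wayne, Comm. Math.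
Phys. 255 (2005) §4 (the weighted space `L²(G⁻¹)`).
-/

set_option linter.dupNamespace false

noncomputable section

open scoped RealInnerProductSpace Topology
open MeasureTheory WithLp Function

namespace Summit.AnomalousDissipation.AnomalousDissipation.Theorems.MarginalStabilityChainStretchedVortexRows

open Literature.Analysis.FluidPDE

/-- `G⁻¹` is differentiable with `D(G⁻¹)(ξ)[v] = ½ ⟪ξ, v⟫ G(ξ)⁻¹` (from `DG(ξ)[v] = −(G(ξ)/2)⟪ξ, v⟫`). [folklore] -/
theorem hasFDerivAt_inv_gaussVortexProfile (ξ : EuclideanSpace ℝ (Fin 2)) :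
    HasFDerivAt (fun η => (gaussVortexProfile η)⁻¹)
      (((gaussVortexProfile ξ)⁻¹ / 2) • innerSL ℝ ξ) ξ := by
  have hG : HasFDerivAt gaussVortexProfile (fderiv ℝ gaussVortexProfile ξ) ξ :=
    ((contDiff_gaussVortexProfile (n := 1)).differentiable one_ne_zero ξ).hasFDerivAt
  have hne : gaussVortexProfile ξ ≠ 0 := (gaussVortexProfile_pos ξ).ne'
  have h : HasFDerivAt (fun η => (gaussVortexProfile η)⁻¹)
      ((ContinuousLinearMap.toSpanSingleton ℝ (-(gaussVortexProfile ξ ^ 2)⁻¹)).comp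
        (fderiv ℝ gaussVortexProfile ξ)) ξ :=
    (hasFDerivAt_inv hne).comp ξ hG
  refine h.congr_fderiv ?_
  ext v
  simp only [ContinuousLinearMap.comp_apply, ContinuousLinearMap.toSpanSingleton_apply,
    FunLike.coe_smul, Pi.smul_apply, smul_eq_mul, innerSL_apply_apply, fderiv_gaussVortexProfile_apply]
  field_simp

/-- **The quadratic form of the cut-off strain in `L²(G⁻¹)`.** For `χ ∈ C¹_c(ℝ²)`, `w ∈ C¹(ℝ²)` and the trace-free linear strain
`Bξ = (b₁ξ₀ + b₂ξ₁, b₂ξ₀ − b₁ξ₁)`: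
`∫ G⁻¹ w (χ Bξ·∇w + (∇χ·Bξ) w) = ∫ G⁻¹ w² (½ ∇χ·Bξ − ¼ χ ξ·Bξ)`. [folklore] -/
theorem coreStrain_form_identity :
    ∀ (b₁ b₂ : ℝ) (χ w : EuclideanSpace ℝ (Fin 2) → ℝ), ContDiff ℝ 1 χ → HasCompactSupport χ → ContDiff ℝ 1 w →
      ∫ ξ, (gaussVortexProfile ξ)⁻¹ * w ξ *
          (χ ξ * ⟪toLp 2 ![b₁ * ξ 0 + b₂ * ξ 1, b₂ * ξ 0 - b₁ * ξ 1], gradient w ξ⟫ +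
            ⟪gradient χ ξ, toLp 2 ![b₁ * ξ 0 + b₂ * ξ 1, b₂ * ξ 0 - b₁ * ξ 1]⟫ * w ξ) =
        ∫ ξ, (gaussVortexProfile ξ)⁻¹ * w ξ ^ 2 *
          (1 / 2 * ⟪gradient χ ξ, toLp 2 ![b₁ * ξ 0 + b₂ * ξ 1, b₂ * ξ 0 - b₁ * ξ 1]⟫ -
            1 / 4 * χ ξ * ⟪ξ, toLp 2 ![b₁ * ξ 0 + b₂ * ξ 1, b₂ * ξ 0 - b₁ * ξ 1]⟫) := by
  intro b₁ b₂ χ w hχ hχc hw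
  -- the strain field as a continuous linear map `T`, and `V = ⇑T`
  set V : EuclideanSpace ℝ (Fin 2) → EuclideanSpace ℝ (Fin 2) :=
    fun ξ => toLp 2 ![b₁ * ξ 0 + b₂ * ξ 1, b₂ * ξ 0 - b₁ * ξ 1] with hVdef
  set ℓ₀ : EuclideanSpace ℝ (Fin 2) →L[ℝ] ℝ :=
    b₁ • EuclideanSpace.proj (0 : Fin 2) + b₂ • EuclideanSpace.proj (1 : Fin 2) with hℓ₀
  set ℓ₁ : EuclideanSpace ℝ (Fin 2) →L[ℝ] ℝ :=
    b₂ • EuclideanSpace.proj (0 : Fin 2) - b₁ • EuclideanSpace.proj (1 : Fin 2) with hℓ₁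
  set T : EuclideanSpace ℝ (Fin 2) →L[ℝ] EuclideanSpace ℝ (Fin 2) :=
    ℓ₀.smulRight (EuclideanSpace.single (0 : Fin 2) (1 : ℝ)) +
      ℓ₁.smulRight (EuclideanSpace.single (1 : Fin 2) (1 : ℝ)) with hT
  have hTV : ∀ ξ, T ξ = V ξ := by
    intro ξ
    ext i
    fin_cases i <;>
      simp [hT, hℓ₀, hℓ₁, hVdef]
  have hTV' : (⇑T) = V := funext hTV
  have hVd : ∀ ξ, HasFDerivAt V T ξ := fun ξ => by
    have h := T.hasFDerivAt (x := ξ)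
    rwa [hTV'] at h
  have hVc : ContDiff ℝ 1 V := by rw [← hTV']; exact T.contDiff
  have hVcont : Continuous V := hVc.continuous
  -- `div V = tr B = 0`
  have hdivV : ∀ ξ, VectorCalculus.divergence V ξ = 0 := by
    intro ξ
    rw [divergence_eq_sum_inner_fderiv (EuclideanSpace.basisFun (Fin 2) ℝ), (hVd ξ).fderiv,
      Fin.sum_univ_two]
    simp [hT, hℓ₀, hℓ₁, EuclideanSpace.basisFun_apply, EuclideanSpace.inner_single_left]
  -- the two factors of the integration by parts
  set G : EuclideanSpace ℝ (Fin 2) → ℝ := gaussVortexProfile with hGdef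
  set θ : EuclideanSpace ℝ (Fin 2) → ℝ := fun ξ => (G ξ)⁻¹ * w ξ ^ 2 with hθdef
  set ψ : EuclideanSpace ℝ (Fin 2) → EuclideanSpace ℝ (Fin 2) := fun ξ => χ ξ • V ξ with hψdef
  have hGinv : ContDiff ℝ 1 fun ξ => (G ξ)⁻¹ :=
    (contDiff_gaussVortexProfile (n := 1)).inv fun ξ => (gaussVortexProfile_pos ξ).ne'
  have hθ : ContDiff ℝ 1 θ := hGinv.mul (hw.pow 2)
  have hψ : ContDiff ℝ 1 ψ := hχ.smul hVc
  have hψc : HasCompactSupport ψ := hχc.smul_right (f' := V)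
  have key := integral_mul_divergence_add_eq_zero_right hθ hψ hψc
  -- pointwise computations
  have hwd : ∀ ξ, HasFDerivAt w (fderiv ℝ w ξ) ξ := fun ξ => (hw.differentiable one_ne_zero ξ).hasFDerivAt
  have hθd : ∀ ξ v, fderiv ℝ θ ξ v = (G ξ)⁻¹ * (⟪ξ, v⟫ / 2 * w ξ ^ 2 + 2 * w ξ * fderiv ℝ w ξ v) := by
    intro ξ v
    have h1 := hasFDerivAt_inv_gaussVortexProfile ξ
    have h2 : HasFDerivAt (fun η => w η ^ 2) ((2 * w ξ) • fderiv ℝ w ξ) ξ := by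
      simpa using (hwd ξ).pow 2
    have h : HasFDerivAt (fun η => (gaussVortexProfile η)⁻¹ * w η ^ 2)
        ((gaussVortexProfile ξ)⁻¹ • ((2 * w ξ) • fderiv ℝ w ξ) +
          w ξ ^ 2 • (((gaussVortexProfile ξ)⁻¹ / 2) • innerSL ℝ ξ)) ξ := h1.mul h2
    rw [show θ = fun η => (gaussVortexProfile η)⁻¹ * w η ^ 2 from rfl, h.fderiv]
    simp only [FunLike.coe_add, Pi.add_apply, FunLike.coe_smul, Pi.smul_apply,
      smul_eq_mul, innerSL_apply_apply, hGdef]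
    ring
  have hdivψ : ∀ ξ, VectorCalculus.divergence ψ ξ = ⟪V ξ, gradient χ ξ⟫ := by
    intro ξ
    rw [hψdef, divergence_smul_apply (hχ.differentiable one_ne_zero ξ) (hVd ξ).differentiableAt, hdivV,
      mul_zero, zero_add]
  have hpair : ∀ ξ, ⟪ψ ξ, gradient θ ξ⟫ =
      χ ξ * ((G ξ)⁻¹ * (⟪ξ, V ξ⟫ / 2 * w ξ ^ 2 + 2 * w ξ * ⟪V ξ, gradient w ξ⟫)) := by
    intro ξ
    rw [hψdef]
    simp only [RCLike.conj_to_real, inner_gradient_right, hθd, inner_smul_right, map_smul, smul_eq_mul]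
    ring
  -- integrability of the three elementary integrals
  have hGic : Continuous fun ξ => (G ξ)⁻¹ := hGinv.continuous
  have hgradw : Continuous (gradient w) := continuous_gradient_of_contDiff hw
  have hgradχ : Continuous (gradient χ) := continuous_gradient_of_contDiff hχ
  have hcA : Continuous fun ξ => χ ξ * ((G ξ)⁻¹ * w ξ * ⟪V ξ, gradient w ξ⟫) :=
    hχ.continuous.mul ((hGic.mul hw.continuous).mul (hVcont.inner hgradw))
  have hiA : Integrable fun ξ => χ ξ * ((G ξ)⁻¹ * w ξ * ⟪V ξ, gradient w ξ⟫) :=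
    hcA.integrable_of_hasCompactSupport hχc.mul_right
  have hgradχc : HasCompactSupport (gradient χ) := by
    refine (hχc.fderiv (𝕜 := ℝ)).mono ?_
    intro ξ hξ
    contrapose! hξ
    simp only [mem_support, not_not] at hξ ⊢
    change (InnerProductSpace.toDual ℝ (EuclideanSpace ℝ (Fin 2))).symm (fderiv ℝ χ ξ) = 0
    rw [hξ, map_zero]
  have hcB : Continuous fun ξ => (G ξ)⁻¹ * w ξ ^ 2 * ⟪gradient χ ξ, V ξ⟫ :=
    (hGic.mul (hw.continuous.pow 2)).mul (hgradχ.inner hVcont)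
  have hiB : Integrable fun ξ => (G ξ)⁻¹ * w ξ ^ 2 * ⟪gradient χ ξ, V ξ⟫ := by
    refine hcB.integrable_of_hasCompactSupport (hgradχc.mono ?_)
    intro ξ hξ
    contrapose! hξ
    simp only [mem_support, not_not] at hξ ⊢
    rw [hξ, inner_zero_left, mul_zero]
  have hcC : Continuous fun ξ => χ ξ * ((G ξ)⁻¹ * ⟪ξ, V ξ⟫ * w ξ ^ 2) :=
    hχ.continuous.mul ((hGic.mul (continuous_id.inner hVcont)).mul (hw.continuous.pow 2))
  have hiC : Integrable fun ξ => χ ξ * ((G ξ)⁻¹ * ⟪ξ, V ξ⟫ * w ξ ^ 2) :=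
    hcC.integrable_of_hasCompactSupport hχc.mul_right
  set IA : ℝ := ∫ ξ, χ ξ * ((G ξ)⁻¹ * w ξ * ⟪V ξ, gradient w ξ⟫) with hIA
  set IB : ℝ := ∫ ξ, (G ξ)⁻¹ * w ξ ^ 2 * ⟪gradient χ ξ, V ξ⟫ with hIB
  set IC : ℝ := ∫ ξ, χ ξ * ((G ξ)⁻¹ * ⟪ξ, V ξ⟫ * w ξ ^ 2) with hIC
  -- the integration by parts in terms of IA, IB, IC:  IB + (IC/2 + 2 IA) = 0
  have hkey : IB + (1 / 2 * IC + 2 * IA) = 0 := by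
    have e1 : ∫ ξ, θ ξ * VectorCalculus.divergence ψ ξ = IB := by
      rw [hIB]
      refine integral_congr_ae (Filter.Eventually.of_forall fun ξ => ?_)
      simp only [hθdef, hdivψ, real_inner_comm (V ξ)]
    have e2 : ∫ ξ, ⟪ψ ξ, gradient θ ξ⟫ = 1 / 2 * IC + 2 * IA := by
      rw [hIC, hIA, ← integral_const_mul, ← integral_const_mul, ← integral_add]
      · refine integral_congr_ae (Filter.Eventually.of_forall fun ξ => ?_)
        simp only [hpair]
        ring
      · exact hiC.const_mul _
      · exact hiA.const_mul _
    rw [← e1, ← e2]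
    exact key
  -- the two sides of the claim in terms of IA, IB, IC
  have hL : ∫ ξ, (G ξ)⁻¹ * w ξ * (χ ξ * ⟪V ξ, gradient w ξ⟫ + ⟪gradient χ ξ, V ξ⟫ * w ξ) = IA + IB := by
    rw [hIA, hIB, ← integral_add hiA hiB]
    refine integral_congr_ae (Filter.Eventually.of_forall fun ξ => ?_)
    simp only
    ring
  have hR : ∫ ξ, (G ξ)⁻¹ * w ξ ^ 2 * (1 / 2 * ⟪gradient χ ξ, V ξ⟫ - 1 / 4 * χ ξ * ⟪ξ, V ξ⟫) =
      1 / 2 * IB - 1 / 4 * IC := by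
    rw [hIB, hIC, ← integral_const_mul, ← integral_const_mul, ← integral_sub]
    · refine integral_congr_ae (Filter.Eventually.of_forall fun ξ => ?_)
      simp only
      ring
    · exact hiB.const_mul _
    · exact hiC.const_mul _
  change ∫ ξ, (G ξ)⁻¹ * w ξ * (χ ξ * ⟪V ξ, gradient w ξ⟫ + ⟪gradient χ ξ, V ξ⟫ * w ξ) =
    ∫ ξ, (G ξ)⁻¹ * w ξ ^ 2 * (1 / 2 * ⟪gradient χ ξ, V ξ⟫ - 1 / 4 * χ ξ * ⟪ξ, V ξ⟫)
  rw [hL, hR]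
  linarith

end Summit.AnomalousDissipation.AnomalousDissipation.Theorems.MarginalStabilityChainStretchedVortexRows

end
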